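import Summits.ResolutionOfSingularities.ResolutionOfSingularities.Theorems.HilbertSamuelEliminationSigmaMaxModificationsCorridor3WLadderBirthFormsNear
import HarnessLib

/-!
# [OURS · L1 W4.2] (b-end)₃ W-TOP BIRTHS — FIRST DELIVERABLE: the ONE-STEP grade-3 birth law in the POLYNOMIAL MODEL
# («near directions of ALL charts are COLLINEAR below the 6/5 band»), from `birthTidy` + `birthNear`
# (cell res-hironaka, LADDER-RESOLUTION rung L; slot W4.2, crux chain w42 `SigmaMaxModificationsCorridor3`
# stmt-ResolutionOfSingularities-19249; `--supports stmt-ResolutionOfSingularities-19249 --as helper`; res-L1-w42-plan-1 W4.2 DEAL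
# 2026-08-27T07:34:07Z object D9, hand res-D-pv-002)

Everything here is OURS (elementary `MvPolynomial` algebra over a field, by name over `…Corridor3WLadderBirthDefs` p505417 /
`…BirthForms` p506417 / `…BirthFormsNear` p507123); NOT a statement of Hironaka's manuscript [Hironaka2017] nor of
[CossartJannsenSaito2020]; no `Literature.…` named fact; never a `Theses/…` import. AI-written; no expert review; AI review is
weaker than expert review.

## What the row (b-end)₃ needs and what this file gives

Row `Moving.StrataCycleEndBirthsSettle p 3 (QNe Q) (fun s => 3 ≤ s.geomDirDim)` (`…Corridor3WLadderStrataBirths.lean`, OPEN,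
CORE): at late blown-up cycle-end steps of a moving W-top chain no component of `X_{n+1}(ν)` through the chain point is newborn.
At `ē(x_n) = 3` the near part of the fibre is NOT finite (it is cut out of `ℙ(Dir_{x_n}/T_{x_n}D) ≅ ℙ²` or `ℙ¹` by the birth
conditions), so the `ē ≤ 2` argument of the row's docstring does not apply; what constrains births is idea-1's §8 numerology.
This file proves its ONE-STEP form in the polynomial model of the graded data (the setting of `BirthNear`: one coefficient `c`
of `h = Y^m + Σ c_i Y^i`, `q = m − i`, `d = ord c`, `F = in_d(c)`), for near points taken in ANY of the three charts `U_j ≠ 0`: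

* `Birth.vanishesToOrder_initialForm_of_near` — chart `j`, point `b` of the exceptional divisor (`b_j = 0`) NEAR for the
  coefficient (`c′ = χ_j(c)/U_j^q` vanishes to order `q` at `b`) ⇒ the initial form `in_d(c)` vanishes to order `2q − d` at the
  direction `b̂ = (b, b_j := 1)` (= `birthNear` by name, binder bookkeeping only).
* `Birth.not_linearIndependent_of_near` — **ONE-STEP BIRTH LAW (B-collinear)**: if `in_d(c) ≠ 0` and the index is in the band
  `2d < 3(2q − d)` (i.e. `δ = d/q < 6/5`, `birth_band_iff`), then any three near points `b¹, b², b³`, each read in its own chart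
  `j₁, j₂, j₃`, have LINEARLY DEPENDENT directions `b̂¹, b̂², b̂³` — all near directions of this coefficient lie on ONE LINE of
  `ℙ(Dir)`, whatever the characteristic and the residue field (`birthTidy` by name on `F = in_d(c)`).
* `Birth.not_linearIndependent_of_near_min` — the same for a family of coefficients `(c_i)_{i<m}`: a point near for ALL `i`
  (multiplicity still `m`) is near for the index `i₀` attaining the band, so the law applies with that single index.

## What is NOT here (honest scope, for plan-1's re-cut)

The scheme-level row needs the DICTIONARY «newborn irreducible component of `X_{n+1}(ν)` through a point over `x_n` ↦ near
direction `[b] ∈ ℙ(Dir_{x_n}/T_{x_n}D)(κ)` with `VanishesToOrder (in_{d_i} c_i) b̂ (2(m−i) − d_i)` for every `i`» at a blown-up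
cycle-end step from an `ē = 3` point (CJS Thm. 3.14 places near points on `ℙ(Dir/T_D)`; the birth bounds are the graded reading
of «multiplicity still `m`»), plus a NO-RECURRENT-BIRTH mechanism along the chain; neither is typed in the tree today (idea-1
§8 calls it the K3d frontier). SPECIMEN for tri-1 (recurrent-birth candidate at the band's edge `δ = 6/5`, where the law is
SHARP): `h = Y⁵ + (U₀U₁U₂)²` — `d = 6`, `q = 5`, `μ = 2q − d = 4`, `2d = 12 = 3μ` (NOT in the band), and the three coordinate
directions `e₀, e₁, e₂` ARE near and non-collinear (`(U₀U₁U₂)²` vanishes to order `4` at each `e_t`); the next step at `e_t` is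
the object to bench.
-/

noncomputable section

set_option linter.dupNamespace false

namespace Summit.ResolutionOfSingularities.ResolutionOfSingularities.Theorems.SigmaMaxModificationsCorridor3.Birth

open MvPolynomial

/-- [OURS · L1 W4.2] **Near in chart `j` at `b` ⇒ the initial form vanishes to order `2q − d` at `b̂`** — `birthNear` by name,
with the binders of the graded setting (`i < m`, `q = m − i ≤ d = ord c`). NOT a statement of the manuscript. [folklore] -/
theorem vanishesToOrder_initialForm_of_near {k : Type} [Field k] {m i d : ℕ} (him : i < m) (hqd : m - i ≤ d)
    {c : MvPolynomial (Fin 3) k} (hc : ∀ n < d, homogeneousComponent n c = 0) (j : Fin 3) {b : Fin 3 → k} (hbj : b j = 0)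
    {c' : MvPolynomial (Fin 3) k}
    (hchart : c' * X j ^ (m - i) = aeval (fun l : Fin 3 => if l = j then (X j : MvPolynomial (Fin 3) k) else X j * X l) c)
    (hnear : VanishesToOrder c' b (m - i)) :
    VanishesToOrder (homogeneousComponent d c) (Function.update b j 1) (2 * (m - i) - d) :=
  birthNear k m i d j b c c' him hqd hbj hc hchart hnear

/-- [OURS · L1 W4.2] **ONE-STEP BIRTH LAW (B-collinear), polynomial model.** One coefficient `c` of the graded datum
(`q = m − i`, `d = ord c`, initial form `in_d(c) ≠ 0`) in the band `2d < 3(2q − d)` (`δ = d/q < 6/5`): three points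
`b¹, b², b³` of the exceptional divisor, each NEAR in its own chart `U_{j_t} ≠ 0` (`b^t_{j_t} = 0`, `c′_t·U_{j_t}^q = χ_{j_t}(c)`,
`c′_t` of order `≥ q` at `b^t`), never have linearly independent directions `b̂^t = (b^t, b^t_{j_t} := 1)`: ALL near directions
lie on one line of `ℙ(Dir)`, in every characteristic, over every field. Sharp at `δ = 6/5` (`(U₀U₁U₂)²`, module docstring).
Proof: `birthNear` at each `t`, then `birthTidy` on the degree-`d` form `in_d(c)`. NOT a statement of the manuscript. [folklore] -/
theorem not_linearIndependent_of_near {k : Type} [Field k] {m i d : ℕ} (him : i < m) (hqd : m - i ≤ d)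
    {c : MvPolynomial (Fin 3) k} (hc : ∀ n < d, homogeneousComponent n c = 0) (hF : homogeneousComponent d c ≠ 0)
    (hband : 2 * d < 3 * (2 * (m - i) - d)) (j : Fin 3 → Fin 3) (b : Fin 3 → (Fin 3 → k))
    (c' : Fin 3 → MvPolynomial (Fin 3) k) (hbj : ∀ t, b t (j t) = 0)
    (hchart : ∀ t, c' t * X (j t) ^ (m - i) =
      aeval (fun l : Fin 3 => if l = j t then (X (j t) : MvPolynomial (Fin 3) k) else X (j t) * X l) c)
    (hnear : ∀ t, VanishesToOrder (c' t) (b t) (m - i)) :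
    ¬ LinearIndependent k (fun t => Function.update (b t) (j t) 1) := fun hli =>
  birthTidy k (homogeneousComponent d c) d (2 * (m - i) - d) (homogeneousComponent_isHomogeneous d c) hF hband
    (fun t => Function.update (b t) (j t) 1) hli
    fun t => vanishesToOrder_initialForm_of_near him hqd hc (j t) (hbj t) (hchart t) (hnear t)

/-- [OURS · L1 W4.2] **The law for the whole graded datum.** Coefficients `c_i` (`i < m`), each of order `≥ d_i ≥ m − i`, with
chart transforms `c′_{t,i}` in the chart of the near point `b^t`; «`x^t = [b^t]` NEAR» = every `c′_{t,i}` vanishes to order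
`m − i` at `b^t`. If SOME index `i₀` has `in_{d_{i₀}}(c_{i₀}) ≠ 0` in the band `2 d_{i₀} < 3(2(m − i₀) − d_{i₀})` (e.g. the index
attaining `δ(Δ) < 6/5`), then three near points never have linearly independent directions. NOT a statement of the manuscript.
[folklore] -/
theorem not_linearIndependent_of_near_min {k : Type} [Field k] {m : ℕ} {dg : ℕ → ℕ} {c : ℕ → MvPolynomial (Fin 3) k}
    (hqd : ∀ i < m, m - i ≤ dg i) (hc : ∀ i < m, ∀ n < dg i, homogeneousComponent n (c i) = 0)
    {i₀ : ℕ} (hi₀ : i₀ < m) (hF : homogeneousComponent (dg i₀) (c i₀) ≠ 0)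
    (hband : 2 * dg i₀ < 3 * (2 * (m - i₀) - dg i₀)) (j : Fin 3 → Fin 3) (b : Fin 3 → (Fin 3 → k))
    (c' : Fin 3 → ℕ → MvPolynomial (Fin 3) k) (hbj : ∀ t, b t (j t) = 0)
    (hchart : ∀ t, ∀ i < m, c' t i * X (j t) ^ (m - i) =
      aeval (fun l : Fin 3 => if l = j t then (X (j t) : MvPolynomial (Fin 3) k) else X (j t) * X l) (c i))
    (hnear : ∀ t, ∀ i < m, VanishesToOrder (c' t i) (b t) (m - i)) :
    ¬ LinearIndependent k (fun t => Function.update (b t) (j t) 1) :=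
  not_linearIndependent_of_near hi₀ (hqd i₀ hi₀) (hc i₀ hi₀) hF hband j b (fun t => c' t i₀) hbj
    (fun t => hchart t i₀ hi₀) fun t => hnear t i₀ hi₀

/-- [OURS · L1 W4.2] **The SHARPNESS / recurrent-birth specimen is outside the band**: at `δ = 6/5` (`d = 6`, `q = 5`) the band
inequality `2d < 3(2q − d)` fails with EQUALITY — the regime of `(U₀U₁U₂)²`, where three non-collinear near directions occur.
[folklore] -/
theorem band_fails_at_six_fifths : ¬ (2 * 6 < 3 * (2 * 5 - 6)) := by
  decide

end Summit.ResolutionOfSingularities.ResolutionOfSingularities.Theorems.SigmaMaxModificationsCorridor3.Birth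

end
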